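import Summits.BirchSwinnertonDyer.Rank1Residual.ManinAdditive.MinusOneOrbitManinEqOfPrint
import Literature.NumberTheory.EllipticCurves.QuadraticTwistNegOneMinimalDiscriminantProofs
import HarnessLib

/-!
# THEOREM I is a THEOREM: `MinusOneOrbitManinEq` (E-an-10) and `MinusOneTwistRigidity` (E-an-8 (ii)) hold —
# cell `bsd-f2-manin` (D-0131 (3) frontier: the Manin constant at additive primes), analytic lens

The two `@[conjecture]` leaves `MinusOneOrbitManinEq` (E-an-10, `MinusOneOrbitManinEq.lean`, p558368) and
`MinusOneTwistRigidity` (E-an-8 (ii), `MinusOneTwistRigidity.lean`, p551258) were reduced by the planner's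
kernel-checked chain (an Sketch-an5v3/v4/v5 §18–§22, landed as `TwistOrbitManinTransportAtTwoExact`,
`TwistOrbitAtTwoExactDegree`, `MinusOneTwistLatticeRotationProof`, `NegOneOptimalTwistRigidityProof`) to ONE
printed input, the Connell–Pal local lemma `NegOneTwistMinimalDiscrEq` = the Literature named fact
`connellPal_Δ_eq_of_negOne_twist_of_four_dvd_conductor` (`MinusOneOrbitManinEqOfPrint.lean`, p570682), and that
fact is now DISCHARGED in the tree: `connellPal_Δ_eq_of_negOne_twist_of_four_dvd_conductor_holds`
(`Literature/NumberTheory/EllipticCurves/QuadraticTwistNegOneMinimalDiscriminantProofs.lean`, cell `pub/bsd-cited`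
seat r20, p580266: `u = ±1` from Kraus at `2` + `Δ(W′) = u⁻¹²(−1)⁶Δ(W)`).  This file feeds the discharge in:
the leaves hold outright (`_holds`), in the sibling file required by the conjecture-leaf convention (the leaf
modules stay conjecture-only and importable).  CONTENT (E-an-10, informal): on every same-level `χ₋₄`-orbit of
globally minimal curves with `2⁵ ∣ N` (resp. `2⁴ ∣ N` for the sharpened orbit statement), `X₀(N)`-lattice-optimal
data `D, D′` have `c′ = ±c` and `deg φ′ = deg φ`, and `W ⊗ χ₋₄ ≅ W′` — the Manin constant is CONSTANT along optimal
`−1`-twist orbits at additive level `2⁵`.  Refuter placement (HOME/REFUTER-ref2.md v4): E-an-10 NOT-IN-PRINT,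
folklore-provable theorem candidate — now proved in the tree; E-an-8 (ii) likewise.  No `sorry`, nothing new is
asserted; the axiom closure is the standard one of its inputs.
-/

noncomputable section

open scoped MatrixGroups ModularForm

open CongruenceSubgroup WeierstrassCurve
  Literature.NumberTheory.DiophantineGeometry
  Literature.NumberTheory.EllipticCurves
  Literature.NumberTheory.EllipticCurves.ModularForms

namespace Summit.BirchSwinnertonDyer.Rank1Residual.ManinAdditive

/-- **S-an-10 holds**: the hypothesis schema `NegOneTwistMinimalDiscrEq` (= the Connell–Pal lemma: both curves
additive at `2`, `u • (W ⊗ (−1)) = W′` ⟹ `Δ(W′) = Δ(W)`) is the discharged Literature fact. -/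
theorem negOneTwistMinimalDiscrEq_holds : NegOneTwistMinimalDiscrEq :=
  negOneTwistMinimalDiscrEq_of_connellPal connellPal_Δ_eq_of_negOne_twist_of_four_dvd_conductor_holds

/-- **S-an-10 at every level `M` with `4 ∣ M`**: `NegOneTwistSameLevelDiscrEq M` holds. -/
theorem negOneTwistSameLevelDiscrEq_holds {M : ℕ} (hM : 4 ∣ M) : NegOneTwistSameLevelDiscrEq M :=
  negOneTwistSameLevelDiscrEq_of_minimalDiscrEq negOneTwistMinimalDiscrEq_holds hM

/-- **THEOREM I — E-an-10 `MinusOneOrbitManinEq` HOLDS** (leaf p558368 closed): on optimal same-level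
`χ₋₄`-orbits with `2⁵ ∣ N` the Manin constant and the modular degree are invariant (`c′ = ±c`, `deg′ = deg`). -/
theorem minusOneOrbitManinEq_holds : MinusOneOrbitManinEq :=
  minusOneOrbitManinEq_of_connellPal connellPal_Δ_eq_of_negOne_twist_of_four_dvd_conductor_holds

/-- **E-an-8 (ii) `MinusOneTwistRigidity` HOLDS** (leaf p551258 closed; clause (i)
`MinusOneTwistLatticeRotation` was closed by `minusOneTwistLatticeRotation_holds`, p567466). -/
theorem minusOneTwistRigidity_holds : MinusOneTwistRigidity :=
  minusOneTwistRigidity_of_connellPal connellPal_Δ_eq_of_negOne_twist_of_four_dvd_conductor_holds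

/-- **THEOREM I at `2⁴` with the MANIN clause, unconditional** (the landed `negOne_optimal_orbit_sixteen` of
`TwistOrbitScalingEngine` has `deg′ = deg` and `c′¹²Δ′ = c¹²Δ`; here `c′ = ±c`): on every same-level `χ₋₄`-orbit of globally minimal curves with
`16 ∣ N`, lattice-optimal data satisfy `W ⊗ χ₋₄ ≅ W′` (by a variable change), `c′ = ±c` and `deg′ = deg`. -/
theorem negOne_optimal_orbit_sixteen_manin :
    ∀ (W W' : WeierstrassCurve ℚ) [W.IsElliptic] [W.IsGloballyMinimal] [W'.IsElliptic]
    [W'.IsGloballyMinimal] [NeZero (W.conductorNorm ℤ)] [NeZero (W'.conductorNorm ℤ)]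
    (D : ModularParametrizationData W (W.conductorNorm ℤ))
    (D' : ModularParametrizationData W' (W'.conductorNorm ℤ)),
    IsLatticeOptimal D → IsLatticeOptimal D' →
    16 ∣ W.conductorNorm ℤ → W'.conductorNorm ℤ = W.conductorNorm ℤ →
    IsIsogenous (W.quadraticTwist ((-1 : ℤ) : ℚ)) W' →
    (∃ u : VariableChange ℚ, u • W.quadraticTwist ((-1 : ℤ) : ℚ) = W') ∧
      (D'.c = D.c ∨ D'.c = -D.c) ∧ D'.modularDegree = D.modularDegree :=
  negOne_optimal_orbit_sixteen_of_connellPal connellPal_Δ_eq_of_negOne_twist_of_four_dvd_conductor_holds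

/-- **Corollary (the `2`-adic Manin valuation is an orbit invariant at `2⁴`)**: with the data above,
`padicValInt 2 D′.c = padicValInt 2 D.c` — in particular `2 ∣ c′ ↔ 2 ∣ c`. -/
theorem negOne_optimal_orbit_sixteen_padicValInt_c_eq :
    ∀ (W W' : WeierstrassCurve ℚ) [W.IsElliptic] [W.IsGloballyMinimal] [W'.IsElliptic]
    [W'.IsGloballyMinimal] [NeZero (W.conductorNorm ℤ)] [NeZero (W'.conductorNorm ℤ)]
    (D : ModularParametrizationData W (W.conductorNorm ℤ))
    (D' : ModularParametrizationData W' (W'.conductorNorm ℤ)),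
    IsLatticeOptimal D → IsLatticeOptimal D' →
    16 ∣ W.conductorNorm ℤ → W'.conductorNorm ℤ = W.conductorNorm ℤ →
    IsIsogenous (W.quadraticTwist ((-1 : ℤ) : ℚ)) W' →
    padicValInt 2 D'.c = padicValInt 2 D.c ∧ ((2 : ℤ) ∣ D'.c ↔ (2 : ℤ) ∣ D.c) := by
  intro W W' _ _ _ _ _ _ D D' hD hD' h16 hN hiso
  obtain ⟨-, hc, -⟩ := negOne_optimal_orbit_sixteen_manin W W' D D' hD hD' h16 hN hiso
  rcases hc with h | h
  · exact ⟨by rw [h], by rw [h]⟩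
  · refine ⟨by rw [h]; simp [padicValInt, Int.natAbs_neg], ?_⟩
    rw [h]
    exact dvd_neg

end Summit.BirchSwinnertonDyer.Rank1Residual.ManinAdditive

end
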